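import Literature.RingTheory.NoetherNormalization.LinearChange
import Literature.RingTheory.Nullstellensatz.PerronTheorem
import Mathlib.RingTheory.Polynomial.Resultant.Basic
import Mathlib.FieldTheory.IsAlgClosed.Basic
import Mathlib.Algebra.MvPolynomial.Funext
import Mathlib.Algebra.Polynomial.Roots
import HarnessLib

/-!
# Finite surjective linear projections of affine algebraic sets, with small INTEGER coefficients

Topic: `Literature/RingTheory/NoetherNormalization`. The set-theoretic content of Noether
normalisation by linear coordinate changes over an infinite field (Greuel–Pfister, *A Singular
Introduction to Commutative Algebra* (2002), Thm. 3.4.1 and its proof: successive shears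
`x_{i+1} ↦ x_{i+1} + v_i x_0` making a nonzero equation monic in `x_0`, then elimination of `x_0`),
carried out QUANTITATIVELY: for the common zero set `V ⊆ Kᵐ` (`K` algebraically closed of
characteristic `0`) of finitely many polynomials of degree `≤ δ` we produce `r ≤ m` linear forms
`L_1, …, L_r` with INTEGER coefficients of absolute value `≤ projBound m δ` such that
`L = (L_1, …, L_r) : V → Kʳ` has FINITE fibres and, if `V ≠ ∅`, is SURJECTIVE
(`exists_bounded_projection`). In particular `V ∩ {L = 0}` is a non-empty finite set — the
"zero-dimensional slice with small integer equations" used in Bürgisser's proof of TCS 2000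
Thm. 4.5 (there via Lemma 4.4 and Bézout's inequality; here by elimination theory only: the size of
the shears is controlled by the degrees of the ELIMINANTS, which grow doubly exponentially, but only
enter the final height bounds through their logarithm).

The elimination step is the classical **extension theorem in resultant form** (Cox–Little–O'Shea,
*Ideals, Varieties, and Algorithms*, Ch. 3 §6; van der Waerden's `u`-trick): if `f` is monic in
`x_0` then `x' ∈ Kᵐ` extends to a common zero `(y, x')` of `f, g_1, …, g_t` iff all
`U`-coefficients of `Res_{x_0}(f, Σ_k U_k g_k)` vanish at `x'`
(`eval_elimResultant_coeff_eq_zero_iff`, from Mathlib's `resultant_eq_prod_eval`: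
`Res(f, h) = Π_{f(ρ)=0} h(ρ)` for monic split `f`), with the degree bound
`deg ≤ (deg_{x_0} f + e) δ` for these coefficients (`totalDegree_coeff_elimResultant_le`, Leibniz
expansion of the Sylvester determinant).

## Contents (namespace `Literature.RingTheory.NoetherNormalization`, everything proved)

* `CoeffDeg` and its calculus (`add`, `mul`, `prod`, `det`, …) — degree bookkeeping for
  polynomials in auxiliary variables over `K[X_1, …, X_m]`;
* `elimResultant`, `eval_elimResultant_coeff_eq_zero_iff`, `totalDegree_coeff_elimResultant_le` —
  the extension theorem with degrees;
* `projBound`, **`exists_bounded_projection`** — the bounded integer projection with finite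
  fibres, surjective when `V ≠ ∅`.

## References

* G.-M. Greuel, G. Pfister, *A Singular Introduction to Commutative Algebra* (2002), Thm. 3.4.1
  and its proof. [GreuelPfister2002]
* D. Cox, J. Little, D. O'Shea, *Ideals, Varieties, and Algorithms*, Ch. 3, §6 (the extension
  theorem via resultants). [folklore]
* P. Bürgisser, *Cook's versus Valiant's hypothesis*, TCS 235 (2000), Lemma 4.4 / Thm. 4.5.
  [Burgisser2000TCS]
-/

noncomputable section

open MvPolynomial

namespace Literature.RingTheory.NoetherNormalization

variable {K : Type*} [Field K]

/-! ### Degree bookkeeping for polynomials in auxiliary variables over `K[X_1, …, X_m]` -/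

section CoeffDeg

variable {m : ℕ} {τ : Type*}

/-- `CoeffDeg p B`: every coefficient of `p` (a polynomial in auxiliary variables `τ` over
`K[X_1, …, X_m]`) has total degree `≤ B`. [folklore] -/
def CoeffDeg (p : MvPolynomial τ (MvPolynomial (Fin m) K)) (B : ℕ) : Prop :=
  ∀ u, (p.coeff u).totalDegree ≤ B

/-- Monotonicity in the bound. [folklore] -/
theorem CoeffDeg.mono {p : MvPolynomial τ (MvPolynomial (Fin m) K)} {B B' : ℕ} (h : CoeffDeg p B)
    (hB : B ≤ B') : CoeffDeg p B' := fun u => (h u).trans hB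

/-- `0` has every bound. [folklore] -/
theorem coeffDeg_zero (B : ℕ) : CoeffDeg (0 : MvPolynomial τ (MvPolynomial (Fin m) K)) B :=
  fun u => by simp

/-- `1` has every bound. [folklore] -/
theorem coeffDeg_one (B : ℕ) : CoeffDeg (1 : MvPolynomial τ (MvPolynomial (Fin m) K)) B := by
  classical
  intro u
  rw [coeff_one]
  split_ifs <;> simp

/-- Sums. [folklore] -/
theorem CoeffDeg.add {p q : MvPolynomial τ (MvPolynomial (Fin m) K)} {B : ℕ} (hp : CoeffDeg p B)
    (hq : CoeffDeg q B) : CoeffDeg (p + q) B := fun u => by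
  rw [coeff_add]
  exact (totalDegree_add _ _).trans (max_le (hp u) (hq u))

/-- Negation. [folklore] -/
theorem CoeffDeg.neg {p : MvPolynomial τ (MvPolynomial (Fin m) K)} {B : ℕ} (hp : CoeffDeg p B) :
    CoeffDeg (-p) B := fun u => by
  rw [coeff_neg, totalDegree_neg]; exact hp u

/-- Finite sums. [folklore] -/
theorem CoeffDeg.sum {ι : Type*} (s : Finset ι) {f : ι → MvPolynomial τ (MvPolynomial (Fin m) K)}
    {B : ℕ} (h : ∀ i ∈ s, CoeffDeg (f i) B) : CoeffDeg (∑ i ∈ s, f i) B := by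
  classical
  induction s using Finset.induction_on with
  | empty => rw [Finset.sum_empty]; exact coeffDeg_zero B
  | insert a s ha ih =>
    rw [Finset.sum_insert ha]
    exact (h a (Finset.mem_insert_self a s)).add (ih fun i hi => h i (Finset.mem_insert_of_mem hi))

/-- Products: the bounds add. [folklore] -/
theorem CoeffDeg.mul {p q : MvPolynomial τ (MvPolynomial (Fin m) K)} {Bp Bq : ℕ}
    (hp : CoeffDeg p Bp) (hq : CoeffDeg q Bq) : CoeffDeg (p * q) (Bp + Bq) := fun u => by
  classical
  rw [coeff_mul]
  refine totalDegree_finsetSum_le fun x _ => ?_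
  exact (totalDegree_mul _ _).trans (add_le_add (hp _) (hq _))

/-- Finite products. [folklore] -/
theorem CoeffDeg.prod {ι : Type*} (s : Finset ι) {f : ι → MvPolynomial τ (MvPolynomial (Fin m) K)}
    {B : ι → ℕ} (h : ∀ i ∈ s, CoeffDeg (f i) (B i)) :
    CoeffDeg (∏ i ∈ s, f i) (∑ i ∈ s, B i) := by
  classical
  induction s using Finset.induction_on with
  | empty => rw [Finset.prod_empty, Finset.sum_empty]; exact coeffDeg_one 0
  | insert a s ha ih =>
    rw [Finset.prod_insert ha, Finset.sum_insert ha]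
    exact (h a (Finset.mem_insert_self a s)).mul (ih fun i hi => h i (Finset.mem_insert_of_mem hi))

/-- Constants. [folklore] -/
theorem coeffDeg_C {a : MvPolynomial (Fin m) K} {B : ℕ} (ha : a.totalDegree ≤ B) :
    CoeffDeg (C a : MvPolynomial τ (MvPolynomial (Fin m) K)) B := by
  classical
  intro u
  rw [coeff_C]
  split_ifs
  · exact ha
  · simp

/-- Variables. [folklore] -/
theorem coeffDeg_X (k : τ) (B : ℕ) : CoeffDeg (X k : MvPolynomial τ (MvPolynomial (Fin m) K)) B := by
  classical
  intro u
  rw [coeff_X]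
  split_ifs <;> simp

/-- Multiplication by a sign. [folklore] -/
theorem CoeffDeg.units_smul (ε : ℤˣ) {p : MvPolynomial τ (MvPolynomial (Fin m) K)} {B : ℕ}
    (hp : CoeffDeg p B) : CoeffDeg (ε • p) B := by
  rcases Int.units_eq_one_or ε with h | h
  · rw [h, one_smul]; exact hp
  · rw [h, Units.smul_def, Units.val_neg, Units.val_one, neg_one_smul]; exact hp.neg

/-- **Determinants**: if all entries have coefficient degrees `≤ B`, the determinant has
coefficient degrees `≤ (size) · B` (Leibniz expansion). [folklore] -/
theorem CoeffDeg.det {ι : Type*} [Fintype ι] [DecidableEq ι]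
    {M : Matrix ι ι (MvPolynomial τ (MvPolynomial (Fin m) K))} {B : ℕ}
    (h : ∀ i j, CoeffDeg (M i j) B) : CoeffDeg M.det (Fintype.card ι * B) := by
  rw [Matrix.det_apply]
  refine CoeffDeg.sum _ fun σ _ => CoeffDeg.units_smul _ ?_
  have hprod := CoeffDeg.prod Finset.univ (f := fun i => M (σ i) i) (B := fun _ => B)
    (fun i _ => h _ _)
  rwa [Finset.sum_const, Finset.card_univ, smul_eq_mul] at hprod

end CoeffDeg

/-! ### The extension theorem in resultant form -/

section Elimination

variable {m t : ℕ}

/-- The `u`-resultant eliminating `x_0`: `Res_{x_0}(f, Σ_k U_k g_k) ∈ (K[X_1, …, X_m])[U_1, …, U_t]`,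
computed through `finSuccEquiv : K[X_0, …, X_m] ≃ K[X_1, …, X_m][x_0]`, with formal degrees
`deg_{x_0} f` and `e`. [folklore] -/
def elimResultant (f : MvPolynomial (Fin (m + 1)) K) (g : Fin t → MvPolynomial (Fin (m + 1)) K)
    (e : ℕ) : MvPolynomial (Fin t) (MvPolynomial (Fin m) K) :=
  Polynomial.resultant
    ((finSuccEquiv K m f).map (C : MvPolynomial (Fin m) K →+* MvPolynomial (Fin t) (MvPolynomial (Fin m) K)))
    (∑ k, Polynomial.C (X k) *
      (finSuccEquiv K m (g k)).map (C : MvPolynomial (Fin m) K →+* MvPolynomial (Fin t) (MvPolynomial (Fin m) K)))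
    (finSuccEquiv K m f).natDegree e

/-- Specialising the `u`-resultant at `x' ∈ Kᵐ` and `U = c ∈ Kᵗ` gives the resultant of the
specialised polynomials. [folklore] -/
theorem eval_map_elimResultant (f : MvPolynomial (Fin (m + 1)) K)
    (g : Fin t → MvPolynomial (Fin (m + 1)) K) (e : ℕ) (x' : Fin m → K) (c : Fin t → K) :
    eval c (map (eval x') (elimResultant f g e)) =
      Polynomial.resultant ((finSuccEquiv K m f).map (eval x'))
        (∑ k, Polynomial.C (c k) * (finSuccEquiv K m (g k)).map (eval x'))
        (finSuccEquiv K m f).natDegree e := by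
  set θ : MvPolynomial (Fin t) (MvPolynomial (Fin m) K) →+* K := eval₂Hom (eval x') c with hθ
  have hθC : θ.comp C = eval x' := by ext a <;> simp [hθ]
  have h1 : eval c (map (eval x') (elimResultant f g e)) = θ (elimResultant f g e) := by
    rw [hθ, coe_eval₂Hom, eval₂_eq_eval_map]
  rw [h1, elimResultant, ← Polynomial.resultant_map_map, Polynomial.map_map, hθC]
  congr 1
  rw [Polynomial.map_sum]
  refine Finset.sum_congr rfl fun k _ => ?_
  rw [Polynomial.map_mul, Polynomial.map_C, Polynomial.map_map, hθC, hθ, coe_eval₂Hom, eval₂_X]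

/-- A nonzero `K`-linear combination `Σ_k a_k U_k` (some `a_k ≠ 0`) is a nonzero polynomial.
[folklore] -/
theorem sum_C_mul_X_ne_zero {a : Fin t → K} {k : Fin t} (hk : a k ≠ 0) :
    (∑ j, C (a j) * X j : MvPolynomial (Fin t) K) ≠ 0 := by
  classical
  intro hzero
  have h := congrArg (coeff (Finsupp.single k 1)) hzero
  rw [coeff_sum, coeff_zero, Finset.sum_eq_single k] at h
  · rw [coeff_C_mul, coeff_X, if_pos rfl, mul_one] at h
    exact hk h
  · intro b _ hb
    rw [coeff_C_mul, coeff_X, if_neg (by rw [Finsupp.single_left_inj one_ne_zero]; exact hb),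
      mul_zero]
  · intro h; exact absurd (Finset.mem_univ k) h

/-- **The extension theorem, resultant form** (Cox–Little–O'Shea Ch. 3 §6; van der Waerden's
`u`-trick). Let `K` be algebraically closed, `f ∈ K[X_0, …, X_m]` monic in `X_0`, and
`g_1, …, g_t` of `X_0`-degree `≤ e`. Then a point `x' ∈ Kᵐ` extends to a common zero `(y, x')` of
`f, g_1, …, g_t` iff every `U`-coefficient of `Res_{X_0}(f, Σ_k U_k g_k)` vanishes at `x'`. Proof:
`Res(f(x', ·), Σ c_k g_k(x', ·)) = Π_{ρ : f(x',ρ)=0} Σ_k c_k g_k(x', ρ)` (`resultant_eq_prod_eval`);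
if this vanishes for all `c ∈ Kᵗ` then some root `ρ` kills every `g_k` (a nonzero product of
nonzero linear forms in `c` has a non-zero value over the infinite field `K`). [folklore] -/
theorem eval_elimResultant_coeff_eq_zero_iff [IsAlgClosed K] (f : MvPolynomial (Fin (m + 1)) K)
    (hf : (finSuccEquiv K m f).Monic) (g : Fin t → MvPolynomial (Fin (m + 1)) K) {e : ℕ}
    (he : ∀ k, (finSuccEquiv K m (g k)).natDegree ≤ e) (x' : Fin m → K) :
    (∀ u, eval x' ((elimResultant f g e).coeff u) = 0) ↔
      ∃ y : K, eval (Fin.cons y x') f = 0 ∧ ∀ k, eval (Fin.cons y x') (g k) = 0 := by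
  classical
  set f₀ : Polynomial K := (finSuccEquiv K m f).map (eval x') with hf₀
  set g₀ : Fin t → Polynomial K := fun k => (finSuccEquiv K m (g k)).map (eval x') with hg₀
  have hf₀m : f₀.Monic := hf.map _
  have hf₀0 : f₀ ≠ 0 := hf₀m.ne_zero
  have hN : f₀.natDegree = (finSuccEquiv K m f).natDegree := hf.natDegree_map _
  -- the resultant as a product over the roots of `f₀`
  have hres : ∀ c : Fin t → K, eval c (map (eval x') (elimResultant f g e)) =
      (f₀.roots.map fun ρ => (∑ k, Polynomial.C (c k) * g₀ k).eval ρ).prod := by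
    intro c
    rw [eval_map_elimResultant, ← hf₀, ← hN]
    have hdeg : (∑ k, Polynomial.C (c k) * g₀ k).natDegree ≤ e := by
      refine Polynomial.natDegree_sum_le_of_forall_le _ _ fun k _ => ?_
      exact (Polynomial.natDegree_C_mul_le _ _).trans
        ((Polynomial.natDegree_map_le).trans (he k))
    rw [Polynomial.resultant_eq_prod_eval f₀ _ e hdeg (IsAlgClosed.splits f₀), hf₀m.leadingCoeff,
      one_pow, one_mul]
  -- evaluation of the combination at a root
  have hevc : ∀ (c : Fin t → K) (ρ : K),
      (∑ k, Polynomial.C (c k) * g₀ k).eval ρ = eval c (∑ k, C ((g₀ k).eval ρ) * X k) := by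
    intro c ρ
    rw [Polynomial.eval_finsetSum, map_sum]
    refine Finset.sum_congr rfl fun k _ => ?_
    rw [Polynomial.eval_mul, Polynomial.eval_C, map_mul, eval_C, eval_X, mul_comm]
  -- values of `f`, `g k` at `(y, x')`
  have hevf : ∀ y, eval (Fin.cons y x') f = f₀.eval y := fun y => by
    rw [eval_eq_eval_mv_eval', hf₀]
  have hevg : ∀ y k, eval (Fin.cons y x') (g k) = (g₀ k).eval y := fun y k => by
    rw [eval_eq_eval_mv_eval', hg₀]
  constructor
  · intro hcoeff
    have hmap : map (eval x') (elimResultant f g e) = 0 := by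
      ext u; rw [coeff_map, hcoeff u, coeff_zero]
    have hall : ∀ c : Fin t → K, ∃ ρ ∈ f₀.roots, (∑ k, Polynomial.C (c k) * g₀ k).eval ρ = 0 := by
      intro c
      have h := hres c
      rw [hmap, map_zero] at h
      obtain ⟨ρ, hρ, hρ0⟩ := Multiset.mem_map.1 (Multiset.prod_eq_zero_iff.1 h.symm)
      exact ⟨ρ, hρ, hρ0⟩
    by_contra hno
    push Not at hno
    -- for every root some `g k` does not vanish
    have hno' : ∀ ρ ∈ f₀.roots, ∃ k, (g₀ k).eval ρ ≠ 0 := by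
      intro ρ hρ
      have hfρ : eval (Fin.cons ρ x') f = 0 := by
        rw [hevf]; exact (Polynomial.mem_roots hf₀0).1 hρ
      obtain ⟨k, hk⟩ := hno ρ hfρ
      exact ⟨k, by rwa [hevg] at hk⟩
    set Ψ : MvPolynomial (Fin t) K :=
      ∏ ρ ∈ f₀.roots.toFinset, ∑ k, C ((g₀ k).eval ρ) * X k with hΨ
    have hΨ0 : Ψ ≠ 0 := by
      rw [hΨ, Finset.prod_ne_zero_iff]
      intro ρ hρ
      obtain ⟨k, hk⟩ := hno' ρ (Multiset.mem_toFinset.1 hρ)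
      exact sum_C_mul_X_ne_zero hk
    apply hΨ0
    refine MvPolynomial.funext fun c => ?_
    rw [map_zero, hΨ, map_prod]
    obtain ⟨ρ, hρ, hρ0⟩ := hall c
    exact Finset.prod_eq_zero (Multiset.mem_toFinset.2 hρ) (by rw [← hevc, hρ0])
  · rintro ⟨y, hyf, hyg⟩ u
    have hy : y ∈ f₀.roots := by
      rw [Polynomial.mem_roots hf₀0, Polynomial.IsRoot.def, ← hevf]; exact hyf
    have hmap : map (eval x') (elimResultant f g e) = 0 := by
      refine MvPolynomial.funext fun c => ?_
      rw [map_zero, hres c]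
      refine Multiset.prod_eq_zero (Multiset.mem_map.2 ⟨y, hy, ?_⟩)
      rw [hevc, map_sum]
      refine Finset.sum_eq_zero fun k _ => ?_
      rw [map_mul, eval_C, ← hevg, hyg k, zero_mul]
    have h := congrArg (coeff u) hmap
    rwa [coeff_map, coeff_zero] at h

/-- Degree of the `x_0`-coefficients: `deg (f)_i ≤ deg f`. [folklore] -/
theorem totalDegree_coeff_finSuccEquiv_le (p : MvPolynomial (Fin (m + 1)) K) (i : ℕ) :
    ((finSuccEquiv K m p).coeff i).totalDegree ≤ p.totalDegree := by
  by_cases h : (finSuccEquiv K m p).coeff i = 0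
  · rw [h, totalDegree_zero]; exact Nat.zero_le _
  · exact le_trans (Nat.le_add_right _ _) (totalDegree_coeff_finSuccEquiv_add_le p i h)

/-- **Degrees of the eliminants**: every `U`-coefficient of `Res_{x_0}(f, Σ U_k g_k)` has total
degree `≤ (deg_{x_0} f + e) · δ` if `deg f, deg g_k ≤ δ`. [folklore] -/
theorem totalDegree_coeff_elimResultant_le (f : MvPolynomial (Fin (m + 1)) K)
    (g : Fin t → MvPolynomial (Fin (m + 1)) K) (e : ℕ) {δ : ℕ} (hf : f.totalDegree ≤ δ)
    (hg : ∀ k, (g k).totalDegree ≤ δ) (u : Fin t →₀ ℕ) :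
    ((elimResultant f g e).coeff u).totalDegree ≤ ((finSuccEquiv K m f).natDegree + e) * δ := by
  classical
  have hdet : CoeffDeg (elimResultant f g e) (((finSuccEquiv K m f).natDegree + e) * δ) := by
    unfold elimResultant Polynomial.resultant
    have h := CoeffDeg.det (B := δ)
      (M := Polynomial.sylvester
        ((finSuccEquiv K m f).map (C : MvPolynomial (Fin m) K →+* MvPolynomial (Fin t) (MvPolynomial (Fin m) K)))
        (∑ k, Polynomial.C (X k) *
          (finSuccEquiv K m (g k)).map (C : MvPolynomial (Fin m) K →+* MvPolynomial (Fin t) (MvPolynomial (Fin m) K)))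
        (finSuccEquiv K m f).natDegree e) ?_
    · rwa [Fintype.card_fin] at h
    · intro i j
      have hF : ∀ i, CoeffDeg (((finSuccEquiv K m f).map
          (C : MvPolynomial (Fin m) K →+* MvPolynomial (Fin t) (MvPolynomial (Fin m) K))).coeff i) δ := by
        intro i
        rw [Polynomial.coeff_map]
        exact coeffDeg_C ((totalDegree_coeff_finSuccEquiv_le f i).trans hf)
      have hG : ∀ i, CoeffDeg ((∑ k, Polynomial.C (X k) * (finSuccEquiv K m (g k)).map
          (C : MvPolynomial (Fin m) K →+* MvPolynomial (Fin t) (MvPolynomial (Fin m) K))).coeff i) δ := by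
        intro i
        rw [Polynomial.finsetSum_coeff]
        refine CoeffDeg.sum _ fun k _ => ?_
        rw [Polynomial.coeff_C_mul, Polynomial.coeff_map]
        have := (coeffDeg_X (m := m) (K := K) k 0).mul
          (coeffDeg_C ((totalDegree_coeff_finSuccEquiv_le (g k) i).trans (hg k)))
        rwa [zero_add] at this
      rw [Polynomial.sylvester, Matrix.of_apply]
      induction j using Fin.addCases with
      | left j₁ =>
        rw [Fin.addCases_left]
        split_ifs
        · exact hG _
        · exact coeffDeg_zero _
      | right j₁ =>
        rw [Fin.addCases_right]
        split_ifs
        · exact hF _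
        · exact coeffDeg_zero _
  exact hdet u

end Elimination

/-! ### Bounded integer projections with finite fibres -/

section Projection

variable {m : ℕ}

/-- The zero set in `Kᵐ` of a finite family of polynomials. [folklore] -/
def zeros (E : Finset (MvPolynomial (Fin m) K)) : Set (Fin m → K) := {x | ∀ e ∈ E, eval x e = 0}

/-- Membership in `zeros E`. [folklore] -/
theorem mem_zeros {E : Finset (MvPolynomial (Fin m) K)} {x : Fin m → K} :
    x ∈ zeros E ↔ ∀ e ∈ E, eval x e = 0 := Iff.rfl

/-- The bound `projBound m δ` for the integer coefficients of the projection
(`projBound 0 δ = 1`, `projBound (m+1) δ = (m+1)(δ+1) · projBound m (2δ²)`). [folklore] -/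
def projBound : ℕ → ℕ → ℕ
  | 0, _ => 1
  | m + 1, δ => (m + 1) * (δ + 1) * projBound m (2 * δ * δ)

/-- `projBound m δ ≥ 1`. [folklore] -/
theorem one_le_projBound : ∀ m δ, 1 ≤ projBound m δ
  | 0, _ => le_rfl
  | m + 1, δ => by
    rw [projBound]
    have := one_le_projBound m (2 * δ * δ)
    calc 1 = 1 * 1 * 1 := by ring
      _ ≤ (m + 1) * (δ + 1) * projBound m (2 * δ * δ) :=
        Nat.mul_le_mul (Nat.mul_le_mul (Nat.succ_le_succ (Nat.zero_le _))
          (Nat.succ_le_succ (Nat.zero_le _))) this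

/-- The point map of the shear: `eval x (linearChange v p) = eval (shearPt v x) p`, where
`shearPt v x = (x_0, x_1 + v_1 x_0, …)`. [folklore] -/
def shearPt (v : Fin m → K) (x : Fin (m + 1) → K) : Fin (m + 1) → K :=
  Fin.cons (x 0) fun i => x i.succ + v i * x 0

/-- The inverse point map of the shear. [folklore] -/
def unshearPt (v : Fin m → K) (y : Fin (m + 1) → K) : Fin (m + 1) → K :=
  Fin.cons (y 0) fun i => y i.succ - v i * y 0

/-- `shearPt ∘ unshearPt = id`. [folklore] -/
theorem shearPt_unshearPt (v : Fin m → K) (y : Fin (m + 1) → K) : shearPt v (unshearPt v y) = y := by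
  unfold shearPt unshearPt
  refine Fin.cases ?_ (fun i => ?_)  |> funext
  · simp
  · simp

/-- `unshearPt ∘ shearPt = id`. [folklore] -/
theorem unshearPt_shearPt (v : Fin m → K) (x : Fin (m + 1) → K) : unshearPt v (shearPt v x) = x := by
  unfold shearPt unshearPt
  refine Fin.cases ?_ (fun i => ?_)  |> funext
  · simp
  · simp

/-- The tail of `unshearPt v y`. [folklore] -/
theorem tail_unshearPt (v : Fin m → K) (y : Fin (m + 1) → K) (i : Fin m) :
    Fin.tail (unshearPt v y) i = y i.succ - v i * y 0 := by
  simp [unshearPt, Fin.tail]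

/-- Values of sheared polynomials: `(linearChange v p)(x) = p(shearPt v x)`. [folklore] -/
theorem eval_linearChange (v : Fin m → K) (x : Fin (m + 1) → K) (p : MvPolynomial (Fin (m + 1)) K) :
    eval x (linearChange v p) = eval (shearPt v x) p := by
  have h : (aeval x : MvPolynomial (Fin (m + 1)) K →ₐ[K] K).comp (linearChange v) = aeval (shearPt v x) := by
    refine MvPolynomial.algHom_ext fun i => ?_
    refine Fin.cases ?_ (fun j => ?_) i
    · simp [shearPt]
    · simp [shearPt]
  have h' : aeval x (linearChange v p) = aeval (shearPt v x) p := by rw [← AlgHom.comp_apply, h]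
  exact h'

/-- **Finite surjective linear projection with small integer coefficients.** Let `K` be an
algebraically closed field of characteristic `0` and `V ⊆ Kᵐ` the common zero set of a finite
family of polynomials of degree `≤ δ`. Then there are `r ≤ m` and linear forms
`L_k = Σ_j L_{kj} x_j` (`k < r`) with integer coefficients `|L_{kj}| ≤ projBound m δ` such that every
fibre `V ∩ {L = c}` (`c ∈ Kʳ`) is FINITE, and NON-EMPTY whenever `V ≠ ∅` (Noether normalisation
by linear changes, Greuel–Pfister 2002 Thm. 3.4.1, set-theoretic content, made quantitative: the
`k`-th shear has coefficients in `{0, …, δ_k}` where `δ_k` bounds the degrees of the `k`-th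
eliminants). [cite: GreuelPfister2002, Thm. 3.4.1] -/
theorem exists_bounded_projection [IsAlgClosed K] [CharZero K] :
    ∀ (m δ : ℕ) (E : Finset (MvPolynomial (Fin m) K)), (∀ e ∈ E, e.totalDegree ≤ δ) →
      ∃ (r : ℕ) (L : Fin r → Fin m → ℤ), r ≤ m ∧ (∀ k j, |L k j| ≤ (projBound m δ : ℤ)) ∧
        (∀ c : Fin r → K, {x ∈ zeros E | ∀ k, ∑ j, (L k j : K) * x j = c k}.Finite) ∧
        ((zeros E).Nonempty →
          ∀ c : Fin r → K, {x ∈ zeros E | ∀ k, ∑ j, (L k j : K) * x j = c k}.Nonempty) := by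
  classical
  intro m
  induction m with
  | zero =>
    intro δ E _
    refine ⟨0, fun k => k.elim0, le_rfl, fun k => k.elim0, fun c => ?_, fun hV c => ?_⟩
    · exact Set.toFinite _
    · obtain ⟨x, hx⟩ := hV
      exact ⟨x, hx, fun k => k.elim0⟩
  | succ m ih =>
    intro δ E hE
    by_cases hall : ∀ e ∈ E, e = 0
    · -- `V = Kᵐ⁺¹`: the identity projection
      refine ⟨m + 1, fun k j => if k = j then 1 else 0, le_rfl, fun k j => ?_, fun c => ?_, fun _ c => ?_⟩
      · dsimp only
        split_ifs
        · rw [abs_one]; exact_mod_cast one_le_projBound (m + 1) δ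
        · rw [abs_zero]; positivity
      · refine (Set.finite_singleton c).subset fun x hx => ?_
        funext k
        have h := hx.2 k
        simpa [Finset.sum_ite_eq] using h
      · refine ⟨c, fun e he => by rw [hall e he, map_zero], fun k => ?_⟩
        simp [Finset.sum_ite_eq]
    push Not at hall
    obtain ⟨f, hfE, hf0⟩ := hall
    by_cases hdeg : f.totalDegree = 0
    · -- `f` is a nonzero constant: `V = ∅`
      obtain ⟨a, rfl⟩ : ∃ a, f = C a := ⟨_, (totalDegree_eq_zero_iff_eq_C).1 hdeg⟩
      have ha : a ≠ 0 := fun h => hf0 (by rw [h, C_0])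
      have hV : zeros E = ∅ := Set.eq_empty_iff_forall_notMem.2 fun x hx => ha (by
        have := hx _ hfE; rwa [eval_C] at this)
      refine ⟨0, fun k => k.elim0, Nat.zero_le _, fun k => k.elim0, fun c => ?_, fun hne => ?_⟩
      · exact (Set.finite_empty.subset fun x hx => by rw [hV] at hx; exact hx.1.elim)
      · rw [hV] at hne; exact absurd hne Set.not_nonempty_empty
    -- the shear making `f` monic in `x_0`
    set S : Finset K := (Finset.range (δ + 1)).image (Nat.cast : ℕ → K) with hS
    have hScard : f.totalDegree < S.card := by
      rw [hS, Finset.card_image_of_injective _ Nat.cast_injective, Finset.card_range]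
      exact Nat.lt_succ_of_le (hE f hfE)
    obtain ⟨v, hvS, c, hc0, hmonic, hNdeg⟩ := exists_linearChange_monic hf0 S hScard
    have hvnat : ∀ i, ∃ n : ℕ, n ≤ δ ∧ (n : K) = v i := fun i => by
      obtain ⟨n, hn, hn'⟩ := Finset.mem_image.1 (hvS i)
      exact ⟨n, Nat.lt_succ_iff.1 (Finset.mem_range.1 hn), hn'⟩
    choose nv hnvδ hnv using hvnat
    set f₁ : MvPolynomial (Fin (m + 1)) K := linearChange v (C c * f) with hf₁
    -- the sheared family and the eliminants
    set t := E.card with ht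
    set g : Fin t → MvPolynomial (Fin (m + 1)) K := fun k => linearChange v (E.equivFin.symm k).1
      with hg
    set R := elimResultant f₁ g δ with hR
    set E' : Finset (MvPolynomial (Fin m) K) := R.support.image fun u => R.coeff u with hE'
    -- degrees
    have hdegLC : ∀ p : MvPolynomial (Fin (m + 1)) K,
        (linearChange v p).totalDegree ≤ p.totalDegree := fun p => by
      unfold linearChange
      have h := Literature.RingTheory.Nullstellensatz.totalDegree_aeval_le
        (Fin.cons (X 0) fun i => X i.succ + C (v i) * X 0 : Fin (m + 1) → MvPolynomial (Fin (m + 1)) K)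
        (δ := 1) (fun i => by
          refine Fin.cases ?_ (fun j => ?_) i
          · simp
          · simp only [Fin.cons_succ]
            refine (totalDegree_add _ _).trans (max_le (by simp) ?_)
            exact (totalDegree_mul _ _).trans (by simp)) p
      rwa [mul_one] at h
    have hf₁deg : f₁.totalDegree ≤ δ := by
      rw [hf₁]
      refine (hdegLC _).trans ((totalDegree_mul _ _).trans ?_)
      rw [totalDegree_C, zero_add]; exact hE f hfE
    have hgdeg : ∀ k, (g k).totalDegree ≤ δ := fun k =>
      (hdegLC _).trans (hE _ (E.equivFin.symm k).2)
    have hgnat : ∀ k, (finSuccEquiv K m (g k)).natDegree ≤ δ := fun k => by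
      rw [natDegree_finSuccEquiv]; exact (degreeOf_le_totalDegree _ _).trans (hgdeg k)
    have hE'deg : ∀ a ∈ E', a.totalDegree ≤ 2 * δ * δ := by
      intro a ha
      obtain ⟨u, -, rfl⟩ := Finset.mem_image.1 ha
      refine (totalDegree_coeff_elimResultant_le f₁ g δ hf₁deg hgdeg u).trans ?_
      have hN : (finSuccEquiv K m f₁).natDegree ≤ δ := by rw [hNdeg]; exact hE f hfE
      calc ((finSuccEquiv K m f₁).natDegree + δ) * δ ≤ (δ + δ) * δ :=
            Nat.mul_le_mul_right _ (Nat.add_le_add_right hN _)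
        _ = 2 * δ * δ := by ring
    -- the zero set of `E'` is the projection of the sheared zero set
    have hZv : ∀ x : Fin (m + 1) → K, (shearPt v x ∈ zeros E) ↔
        (eval x f₁ = 0 ∧ ∀ k, eval x (g k) = 0) := by
      intro x
      constructor
      · intro hx
        refine ⟨?_, fun k => ?_⟩
        · rw [hf₁, eval_linearChange, map_mul, eval_C, hx f hfE, mul_zero]
        · rw [hg]; dsimp only; rw [eval_linearChange]; exact hx _ (E.equivFin.symm k).2
      · rintro ⟨-, hxg⟩ e he
        have h := hxg (E.equivFin ⟨e, he⟩)
        rw [hg] at h; dsimp only at h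
        rwa [Equiv.symm_apply_apply, eval_linearChange] at h
    have hZ' : ∀ x' : Fin m → K, x' ∈ zeros E' ↔ ∃ y, shearPt v (Fin.cons y x') ∈ zeros E := by
      intro x'
      have hiff := eval_elimResultant_coeff_eq_zero_iff f₁ hmonic g hgnat x'
      rw [← hR] at hiff
      simp_rw [hZv]
      rw [← hiff, mem_zeros, hE']
      constructor
      · intro h u
        by_cases hu : u ∈ R.support
        · exact h _ (Finset.mem_image.2 ⟨u, hu, rfl⟩)
        · rw [notMem_support_iff.1 hu, map_zero]
      · intro h a ha
        obtain ⟨u, -, rfl⟩ := Finset.mem_image.1 ha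
        exact h u
    -- induction hypothesis for `E'`
    obtain ⟨r, L', hr, hL'bd, hfin', hsurj'⟩ := ih (2 * δ * δ) E' hE'deg
    -- the new linear forms
    set L : Fin r → Fin (m + 1) → ℤ := fun k => Fin.cons (-∑ j, L' k j * nv j) (L' k) with hL
    have hLval : ∀ (k : Fin r) (y : Fin (m + 1) → K),
        ∑ j, (L k j : K) * y j = ∑ j, (L' k j : K) * Fin.tail (unshearPt v y) j := by
      intro k y
      rw [Fin.sum_univ_succ, hL]
      simp only [Fin.cons_zero, Fin.cons_succ, tail_unshearPt, ← hnv]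
      push_cast
      rw [neg_mul, Finset.sum_mul, ← Finset.sum_neg_distrib, ← Finset.sum_add_distrib]
      refine Finset.sum_congr rfl fun j _ => ?_
      ring
    refine ⟨r, L, hr.trans (Nat.le_succ m), ?_, ?_, ?_⟩
    · -- bounds
      intro k j
      refine Fin.cases ?_ (fun i => ?_) j
      · rw [hL]; dsimp only; rw [Fin.cons_zero, abs_neg]
        calc |∑ j, L' k j * nv j| ≤ ∑ j, |L' k j * nv j| := Finset.abs_sum_le_sum_abs _ _
          _ ≤ ∑ _j : Fin m, (projBound m (2 * δ * δ) : ℤ) * δ := Finset.sum_le_sum fun j _ => by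
              rw [abs_mul, Nat.abs_cast]
              exact mul_le_mul (hL'bd k j) (by exact_mod_cast hnvδ j) (by positivity) (by positivity)
          _ = m * (projBound m (2 * δ * δ) * δ) := by
              rw [Finset.sum_const, Finset.card_univ, Fintype.card_fin, nsmul_eq_mul]
          _ ≤ (projBound (m + 1) δ : ℤ) := by
              rw [projBound]; push_cast
              have h1 : (0 : ℤ) ≤ projBound m (2 * δ * δ) := by positivity
              nlinarith
      · rw [hL]; dsimp only; rw [Fin.cons_succ]
        refine (hL'bd k i).trans ?_
        rw [projBound]; push_cast
        calc (projBound m (2 * δ * δ) : ℤ) = 1 * 1 * projBound m (2 * δ * δ) := by ring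
          _ ≤ (m + 1) * (δ + 1) * projBound m (2 * δ * δ) := by
            gcongr
            · linarith [show (0 : ℤ) ≤ m by positivity]
            · linarith [show (0 : ℤ) ≤ δ by positivity]
    · -- finite fibres
      intro cv
      have hsub : {x ∈ zeros E | ∀ k, ∑ j, (L k j : K) * x j = cv k} ⊆
          shearPt v '' ⋃ x' ∈ {x' ∈ zeros E' | ∀ k, ∑ j, (L' k j : K) * x' j = cv k},
            (fun y : K => (Fin.cons y x' : Fin (m + 1) → K)) ''
              {y | ((finSuccEquiv K m f₁).map (eval x')).eval y = 0} := by
        intro y hy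
        refine ⟨unshearPt v y, ?_, shearPt_unshearPt v y⟩
        have hyz : shearPt v (unshearPt v y) ∈ zeros E := by rw [shearPt_unshearPt]; exact hy.1
        refine Set.mem_iUnion₂.2 ⟨Fin.tail (unshearPt v y), ⟨?_, fun k => ?_⟩, ?_⟩
        · rw [hZ']
          exact ⟨unshearPt v y 0, by rw [Fin.cons_self_tail]; exact hyz⟩
        · rw [← hLval]; exact hy.2 k
        · refine ⟨unshearPt v y 0, ?_, Fin.cons_self_tail _⟩
          have h := ((hZv _).1 hyz).1
          rw [← Fin.cons_self_tail (unshearPt v y), eval_eq_eval_mv_eval'] at h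
          exact h
      refine Set.Finite.subset (Set.Finite.image _ ?_) hsub
      refine Set.Finite.biUnion (hfin' cv) fun x' _ => Set.Finite.image _ ?_
      have h0 : (finSuccEquiv K m f₁).map (eval x') ≠ 0 := (hmonic.map _).ne_zero
      exact (((finSuccEquiv K m f₁).map (eval x')).roots.toFinset.finite_toSet).subset fun y hy => by
        simpa [Polynomial.mem_roots h0] using hy
    · -- surjectivity
      intro hne cv
      obtain ⟨y₀, hy₀⟩ := hne
      have hne' : (zeros E').Nonempty := by
        refine ⟨Fin.tail (unshearPt v y₀), (hZ' _).2 ⟨unshearPt v y₀ 0, ?_⟩⟩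
        rw [Fin.cons_self_tail, shearPt_unshearPt]; exact hy₀
      obtain ⟨x', hx'z, hx'c⟩ := hsurj' hne' cv
      obtain ⟨y, hy⟩ := (hZ' x').1 hx'z
      refine ⟨shearPt v (Fin.cons y x'), hy, fun k => ?_⟩
      rw [hLval, unshearPt_shearPt, Fin.tail_cons]
      exact hx'c k

end Projection

end Literature.RingTheory.NoetherNormalization
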